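import Mathlib
import Literature.Analysis.FluidPDE.StationaryEulerWavePackets
import Summits.AnomalousDissipation.AnomalousDissipation.Theorems.PointSinkPointFluxConeBoxIterationTools
import Summits.AnomalousDissipation.AnomalousDissipation.Theorems.PointSinkPointFluxConeWildBoxLimitIBP
import HarnessLib

/-!
# Tools (part 1) for the stub `stub_wildBoxLimitTools` (crux `PointSink.PointFluxCone`,
stmt-AnomalousDissipation-19033, line `Sketch`)

The a.e. limit of the box iteration (the `ℝ³`-box version of the tree's
`Literature/Analysis/FluidPDE/StationaryEulerLimit.lean`, Choffrut–Székelyhidi 2014, §2 Step 3):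

* `wildLim_exists_subseq`: an `L²`-Cauchy sequence of continuous fields vanishing off the unit box
  has an a.e. convergent subsequence (Riesz–Fischer along an `L²`-fast subsequence);
* `wildLim_modify`: a measurable, bounded modification of the a.e. limit vanishing off the box;
* `wildLim_pressure`: the pressures `π_k` (`π₀ = 0`, `|π_{k+1} - π_k| ≤ δ 2^{-(k+1)}`) converge
  uniformly to a continuous `π` with `|π| ≤ δ`;
* `wildLim_ae_norm_vel_sq`: closedness of `𝒦^{co}_r` and the vanishing of the defects give
  `w(x) ∈ 𝒦^{co}_{e(x)}` a.e. and `|v|² = e` a.e. on the box;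
* `wildLim_zero_mem_K`: the zero state lies in `𝒦_0`.

References: A. Choffrut, L. Székelyhidi Jr., SIAM J. Math. Anal. 46 (2014), §2 Step 3, Lemma 2.
-/

noncomputable section

open scoped InnerProductSpace ContDiff ENNReal Topology
open Set Function MeasureTheory Metric Filter
open Literature.Analysis.FluidPDE Literature.Analysis.FluidPDE.StationaryEuler
open Literature.Analysis.FunctionSpaces

set_option linter.dupNamespace false

namespace Summit.AnomalousDissipation.AnomalousDissipation.Theorems

/-! ## An `L²`-fast subsequence converges almost everywhere -/

/-- **An a.e. convergent subsequence of an `L²`-Cauchy sequence** of continuous fields vanishing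
off the unit box (Riesz–Fischer along an `L²`-fast subsequence). [folklore] -/
theorem wildLim_exists_subseq {w : ℕ → Ed (Fin 3) → State (Fin 3)} (hwc : ∀ k, Continuous (w k))
    (h0 : ∀ k x, x ∉ box (Fin 3) → w k x = 0)
    (hc : ∀ η : ℝ, 0 < η → ∃ M : ℕ, ∀ n n', M ≤ n → n ≤ n' → ∫ x, ‖w n' x - w n x‖ ^ 2 < η) :
    ∃ ns : ℕ → ℕ, StrictMono ns ∧
      ∀ᵐ x, ∃ l : State (Fin 3), Tendsto (fun i => w (ns i) x) atTop (𝓝 l) := by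
  -- adapted from Literature/Analysis/FluidPDE/StationaryEulerLimit.lean (`thr`, `sub`, `ae_exists_tendsto`)
  choose thr hthr using fun i : ℕ => hc ((1 / 4) ^ i) (by positivity)
  obtain ⟨ns, hns, hle⟩ := extraction_forall_of_eventually' (P := fun i k => thr i ≤ k)
    fun i => ⟨thr i, fun k hk => hk⟩
  refine ⟨ns, hns, ?_⟩
  have hL : ∀ n m, eLpNorm (w (ns m) - w (ns n)) 2 volume =
      ENNReal.ofReal (Real.sqrt (∫ x, ‖w (ns m) x - w (ns n) x‖ ^ 2)) := by
    intro n m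
    have hmem : MemLp (w (ns m) - w (ns n)) 2 volume :=
      ((hwc _).sub (hwc _)).memLp_of_hasCompactSupport
        ((wildBoxIBP_hasCompactSupport (h0 _)).sub (wildBoxIBP_hasCompactSupport (h0 _)))
    rw [hmem.eLpNorm_eq_integral_rpow_norm two_ne_zero ENNReal.ofNat_ne_top, Real.sqrt_eq_rpow]
    norm_num
  have hlt : ∀ N n m, N ≤ n → n ≤ m →
      eLpNorm (w (ns m) - w (ns n)) 2 volume < ENNReal.ofReal ((1 / 2) ^ N) := by
    intro N n m hN hnm
    rw [hL, ENNReal.ofReal_lt_ofReal_iff (by positivity), Real.sqrt_lt' (by positivity)]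
    calc ∫ x, ‖w (ns m) x - w (ns n) x‖ ^ 2 < (1 / 4) ^ N :=
          hthr N _ _ ((hle N).trans (hns.monotone hN)) (hns.monotone hnm)
      _ = ((1 / 2) ^ N) ^ 2 := by rw [← pow_mul, mul_comm, pow_mul]; norm_num
  refine Lp.ae_tendsto_of_cauchy_eLpNorm (f := fun n => w (ns n)) (p := 2)
    (fun n => (hwc _).aestronglyMeasurable) (by norm_num)
    (B := fun N => ENNReal.ofReal ((1 / 2) ^ N)) ?_ fun N n m hn hm => ?_
  · rw [← ENNReal.ofReal_tsum_of_nonneg (fun _ => by positivity) summable_geometric_two]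
    exact ENNReal.ofReal_ne_top
  · show eLpNorm (w (ns n) - w (ns m)) 2 volume < ENNReal.ofReal ((1 / 2) ^ N)
    rcases le_total n m with hnm | hmn
    · rw [eLpNorm_sub_comm]; exact hlt N n m hn hnm
    · exact hlt N m n hm hmn

/-! ## A measurable bounded modification of the limit -/

/-- **A measurable, bounded modification of the a.e. limit**, vanishing off the box: along an
a.e. convergent sequence of continuous fields bounded by `R` and vanishing off the box, there is a
measurable limit field with the same bound and support. [folklore] -/
theorem wildLim_modify {w : ℕ → Ed (Fin 3) → State (Fin 3)} {R : ℝ} (hwc : ∀ k, Continuous (w k))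
    (hR : ∀ k x, ‖w k x‖ ≤ R) (h0 : ∀ k x, x ∉ box (Fin 3) → w k x = 0)
    (hae : ∀ᵐ x, ∃ l : State (Fin 3), Tendsto (fun k => w k x) atTop (𝓝 l)) :
    ∃ wl : Ed (Fin 3) → State (Fin 3), Measurable wl ∧ (∀ x, ‖wl x‖ ≤ R) ∧
      (∀ x, x ∉ box (Fin 3) → wl x = 0) ∧ ∀ᵐ x, Tendsto (fun k => w k x) atTop (𝓝 (wl x)) := by
  obtain ⟨wl₁, hm₁, h₁⟩ := measurable_limit_of_tendsto_metrizable_ae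
    (fun k => (hwc k).measurable.aemeasurable) hae
  have hR0 : 0 ≤ R := (norm_nonneg _).trans (hR 0 0)
  set s : Set (Ed (Fin 3)) := box (Fin 3) ∩ {x | ‖wl₁ x‖ ≤ R} with hs
  have hsm : MeasurableSet s :=
    isOpen_box.measurableSet.inter (measurableSet_le hm₁.norm measurable_const)
  refine ⟨s.indicator wl₁, hm₁.indicator hsm, fun x => ?_, fun x hx => ?_, ?_⟩
  · by_cases hx : x ∈ s
    · rw [indicator_of_mem hx]; exact hx.2
    · rw [indicator_of_notMem hx, norm_zero]; exact hR0
  · exact indicator_of_notMem (fun h => hx h.1) _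
  · filter_upwards [h₁] with x hx
    by_cases hb : x ∈ box (Fin 3)
    · have hxs : x ∈ s := ⟨hb, isClosed_Iic.mem_of_tendsto ((continuous_norm.tendsto _).comp hx)
        (Eventually.of_forall fun k => hR k x)⟩
      rwa [indicator_of_mem hxs]
    · have hw0 : (fun k => w k x) = fun _ => 0 := funext fun k => h0 k x hb
      rw [indicator_of_notMem (fun h => hb h.1), hw0]
      exact tendsto_const_nhds

/-! ## The pressure -/

/-- **Uniform limit of the pressures**: with `π₀ = 0` and increments
`|π_{k+1} - π_k| ≤ δ 2^{-(k+1)}`, all `|π_k| ≤ δ`, and the continuous `π_k` converge (uniformly)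
to a continuous `π` with `|π| ≤ δ`. [folklore] -/
theorem wildLim_pressure {p : ℕ → Ed (Fin 3) → ℝ} {δ : ℝ} (hδ : 0 ≤ δ)
    (hpc : ∀ k, Continuous (p k)) (hp0 : p 0 = fun _ => 0)
    (hinc : ∀ k x, |p (k + 1) x - p k x| ≤ δ / 2 ^ (k + 1)) :
    (∀ k x, |p k x| ≤ δ) ∧ ∃ pl : Ed (Fin 3) → ℝ, Continuous pl ∧ (∀ x, |pl x| ≤ δ) ∧
      ∀ x, Tendsto (fun k => p k x) atTop (𝓝 (pl x)) := by
  have htel : ∀ k x, ∑ m ∈ Finset.range k, (p (m + 1) x - p m x) = p k x := fun k x => by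
    rw [Finset.sum_range_sub (fun m => p m x), hp0, sub_zero]
  have hbd : ∀ k x, |p k x| ≤ δ := fun k x => by
    rw [← htel]
    exact (Finset.abs_sum_le_sum_abs _ _).trans
      ((Finset.sum_le_sum fun m _ => hinc m x).trans (boxIter_sum_half_pow_le hδ k))
  have hgeo : Summable fun k : ℕ => δ / 2 ^ (k + 1) :=
    (summable_geometric_two' δ).congr fun k => by rw [pow_succ]; ring
  have hsum : ∀ x, Summable fun k => p (k + 1) x - p k x := fun x =>
    .of_norm_bounded hgeo fun k => by rw [Real.norm_eq_abs]; exact hinc k x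
  have hlim : ∀ x, Tendsto (fun k => p k x) atTop (𝓝 (∑' k, (p (k + 1) x - p k x))) := fun x => by
    have h := (hsum x).hasSum.tendsto_sum_nat
    simp only [htel] at h
    exact h
  refine ⟨hbd, fun x => ∑' k, (p (k + 1) x - p k x), ?_, fun x => ?_, hlim⟩
  · exact continuous_tsum (fun k => (hpc (k + 1)).sub (hpc k)) hgeo fun k x => by
      rw [Real.norm_eq_abs]; exact hinc k x
  · exact abs_le.2 (isClosed_Icc.mem_of_tendsto (hlim x)
      (Eventually.of_forall fun k => abs_le.1 (hbd k x)))

/-! ## The defect vanishes in the limit -/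

/-- **The defect vanishes in the limit**: along a sequence of continuous, uniformly bounded states
`w_k(x) ∈ 𝒦^{co}_{e(x)}` converging a.e. to `w`, with `∫_{box} (e - |v_k|²) → 0`, the limit lies
in `𝒦^{co}_{e(x)}` a.e. (closedness) and `|v|² = e` a.e. on the box (dominated convergence).
[cite: ChoffrutSzekelyhidi2014, §2 Step 3] -/
theorem wildLim_ae_norm_vel_sq {w : ℕ → Ed (Fin 3) → State (Fin 3)} {wl : Ed (Fin 3) → State (Fin 3)}
    {e : Ed (Fin 3) → ℝ} {ebar R : ℝ} (he : Continuous e) (hebar : ∀ x, e x ≤ ebar)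
    (hwc : ∀ k, Continuous (w k)) (hR : ∀ k x, ‖w k x‖ ≤ R) (hC : ∀ k x, w k x ∈ C (e x))
    (hl : ∀ᵐ x, Tendsto (fun k => w k x) atTop (𝓝 (wl x)))
    (hJ : Tendsto (fun k => ∫ x in box (Fin 3), (e x - ‖vel (w k x)‖ ^ 2)) atTop (𝓝 0)) :
    (∀ᵐ x, wl x ∈ C (e x)) ∧ ∀ᵐ x, x ∈ box (Fin 3) → ‖vel (wl x)‖ ^ 2 = e x := by
  -- adapted from Literature/Analysis/FluidPDE/StationaryEulerLimit.lean (`ae_wlim_mem_C`,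
  -- `ae_norm_vel_wlim_sq`)
  have hCl : ∀ᵐ x, wl x ∈ C (e x) := by
    filter_upwards [hl] with x hx
    exact (isClosed_C (e x)).mem_of_tendsto hx (Eventually.of_forall fun k => hC k x)
  refine ⟨hCl, ?_⟩
  set g : ℕ → Ed (Fin 3) → ℝ := fun k x => e x - ‖vel (w k x)‖ ^ 2 with hg
  set gl : Ed (Fin 3) → ℝ := fun x => e x - ‖vel (wl x)‖ ^ 2 with hgl
  have hgc : ∀ k, Continuous (g k) := fun k =>
    he.sub ((continuous_norm.comp (continuous_vel.comp (hwc k))).pow 2)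
  have hpt : ∀ (x) (s : State (Fin 3)), s ∈ C (e x) → ‖s‖ ≤ R →
      ‖e x - ‖vel s‖ ^ 2‖ ≤ ebar + R ^ 2 := by
    intro x s hs hsR
    rw [Real.norm_eq_abs, abs_le]
    have h1 := norm_vel_sq_le_of_mem_C hs
    have h2 := nonneg_of_mem_C hs
    have h3 := hebar x
    have h4 : ‖vel s‖ ^ 2 ≤ R ^ 2 :=
      pow_le_pow_left₀ (norm_nonneg _) ((norm_vel_le _).trans hsR) 2
    constructor <;> nlinarith [sq_nonneg R]
  have hlim : ∀ᵐ x, Tendsto (fun k => g k x) atTop (𝓝 (gl x)) := by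
    filter_upwards [hl] with x hx
    exact tendsto_const_nhds.sub
      ((((continuous_norm.comp continuous_vel).tendsto _).comp hx).pow 2)
  have hfin : volume (box (Fin 3)) ≠ ⊤ := by rw [volume_box]; exact ENNReal.one_ne_top
  have hbi : Integrable (fun _ => ebar + R ^ 2) (volume.restrict (box (Fin 3))) :=
    (integrableOn_const hfin).integrable
  have hT := tendsto_integral_of_dominated_convergence (μ := volume.restrict (box (Fin 3)))
    (fun _ => ebar + R ^ 2) (fun k => (hgc k).aestronglyMeasurable) hbi
    (fun k => Eventually.of_forall fun x => hpt x _ (hC k x) (hR k x)) (ae_restrict_of_ae hlim)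
  have hJ' : Tendsto (fun k => ∫ x in box (Fin 3), g k x) atTop (𝓝 0) := hJ
  have h0 : ∫ x in box (Fin 3), gl x = 0 := tendsto_nhds_unique hT hJ'
  -- `gl ≥ 0` a.e. and integrable on the box
  have hRl : ∀ᵐ x, ‖wl x‖ ≤ R := by
    filter_upwards [hl] with x hx
    exact isClosed_Iic.mem_of_tendsto ((continuous_norm.tendsto _).comp hx)
      (Eventually.of_forall fun k => hR k x)
  have hgl0 : 0 ≤ᵐ[volume.restrict (box (Fin 3))] gl :=
    ae_restrict_of_ae (hCl.mono fun x hx => sub_nonneg.2 (norm_vel_sq_le_of_mem_C hx))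
  have hgli : Integrable gl (volume.restrict (box (Fin 3))) := by
    refine Integrable.mono' hbi ?_ (ae_restrict_of_ae ?_)
    · exact aestronglyMeasurable_of_tendsto_ae atTop (fun k => (hgc k).aestronglyMeasurable)
        (ae_restrict_of_ae hlim)
    · filter_upwards [hRl, hCl] with x hx hC' using hpt x _ hC' hx
  have hae := (integral_eq_zero_iff_of_nonneg_ae hgl0 hgli).1 h0
  rw [EventuallyEq, ae_restrict_iff' isOpen_box.measurableSet] at hae
  filter_upwards [hae] with x hx hxb
  have h := hx hxb
  simp only [hgl, Pi.zero_apply] at h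
  linarith

/-- The zero state lies in `𝒦_0 = 𝒦_{|vel 0|²}`. [folklore] -/
theorem wildLim_zero_mem_K : (0 : State (Fin 3)) ∈ K (‖vel (0 : State (Fin 3))‖ ^ 2) := by
  refine ⟨rfl, ?_⟩
  simp [tensorSelf]

/-! ## The registered sub-stub -/

/-- **Tools for `stub_wildBoxLimitTools`, part 1** (registered sub-stub `stub_wildBoxLimitTools1`):
the conjunction of `wildLim_exists_subseq`, `wildLim_modify`, `wildLim_pressure`,
`wildLim_ae_norm_vel_sq`, `wildLim_zero_mem_K`. [cite: ChoffrutSzekelyhidi2014, §2 Step 3] -/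
theorem stub_wildBoxLimitTools1 :
    ((∀ (w : ℕ → Ed (Fin 3) → State (Fin 3)), (∀ k, Continuous (w k)) →
      (∀ k x, x ∉ box (Fin 3) → w k x = 0) →
      (∀ η : ℝ, 0 < η → ∃ M : ℕ, ∀ n n', M ≤ n → n ≤ n' → ∫ x, ‖w n' x - w n x‖ ^ 2 < η) →
      ∃ ns : ℕ → ℕ, StrictMono ns ∧
        ∀ᵐ x, ∃ l : State (Fin 3), Tendsto (fun i => w (ns i) x) atTop (𝓝 l)) ∧
    (∀ (w : ℕ → Ed (Fin 3) → State (Fin 3)) (R : ℝ), (∀ k, Continuous (w k)) →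
      (∀ k x, ‖w k x‖ ≤ R) → (∀ k x, x ∉ box (Fin 3) → w k x = 0) →
      (∀ᵐ x, ∃ l : State (Fin 3), Tendsto (fun k => w k x) atTop (𝓝 l)) →
      ∃ wl : Ed (Fin 3) → State (Fin 3), Measurable wl ∧ (∀ x, ‖wl x‖ ≤ R) ∧
        (∀ x, x ∉ box (Fin 3) → wl x = 0) ∧ ∀ᵐ x, Tendsto (fun k => w k x) atTop (𝓝 (wl x))) ∧
    (∀ (p : ℕ → Ed (Fin 3) → ℝ) (δ : ℝ), 0 ≤ δ → (∀ k, Continuous (p k)) → (p 0 = fun _ => 0) →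
      (∀ k x, |p (k + 1) x - p k x| ≤ δ / 2 ^ (k + 1)) →
      (∀ k x, |p k x| ≤ δ) ∧ ∃ pl : Ed (Fin 3) → ℝ, Continuous pl ∧ (∀ x, |pl x| ≤ δ) ∧
        ∀ x, Tendsto (fun k => p k x) atTop (𝓝 (pl x))) ∧
    (∀ (w : ℕ → Ed (Fin 3) → State (Fin 3)) (wl : Ed (Fin 3) → State (Fin 3)) (e : Ed (Fin 3) → ℝ)
      (ebar R : ℝ), Continuous e → (∀ x, e x ≤ ebar) → (∀ k, Continuous (w k)) →
      (∀ k x, ‖w k x‖ ≤ R) → (∀ k x, w k x ∈ C (e x)) →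
      (∀ᵐ x, Tendsto (fun k => w k x) atTop (𝓝 (wl x))) →
      Tendsto (fun k => ∫ x in box (Fin 3), (e x - ‖vel (w k x)‖ ^ 2)) atTop (𝓝 0) →
      (∀ᵐ x, wl x ∈ C (e x)) ∧ ∀ᵐ x, x ∈ box (Fin 3) → ‖vel (wl x)‖ ^ 2 = e x) ∧
    (0 : State (Fin 3)) ∈ K (‖vel (0 : State (Fin 3))‖ ^ 2)) :=
  ⟨fun _ hwc h0 hc => wildLim_exists_subseq hwc h0 hc,
    fun _ _ hwc hR h0 hae => wildLim_modify hwc hR h0 hae,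
    fun _ _ hδ hpc hp0 hinc => wildLim_pressure hδ hpc hp0 hinc,
    fun _ _ _ _ _ he hebar hwc hR hC hl hJ => wildLim_ae_norm_vel_sq he hebar hwc hR hC hl hJ,
    wildLim_zero_mem_K⟩

end Summit.AnomalousDissipation.AnomalousDissipation.Theorems

end
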